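import Summits.BirchSwinnertonDyer.BirchSwinnertonDyer.Theorems.Rank2ObservatoryPadicSymbolTableL
import Literature.NumberTheory.EllipticCurves.Rank1Residual.Typed.PAdicCertificateGoodOrdinary
import Literature.NumberTheory.EllipticCurves.CanonicalPAdicHeightHolds
import Literature.NumberTheory.EllipticCurves.PAdicHeightsRegulatorProofs
import Summits.BirchSwinnertonDyer.Rank1Residual.X2.RankOneHeightFree
import Literature.NumberTheory.EllipticCurves.FormalGroupMultiplication
import Literature.NumberTheory.EllipticCurves.PAdicHeightsLogProofs
import Literature.NumberTheory.EllipticCurves.PadicFiltrationIndexProofs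
import HarnessLib

/-!
# BirchSwinnertonDyer — rank ≥ 2 observatory: HEIGHT-FREE bounds for the unit-cell instrument
# (anom seat, gen 7, join J9; part 1 of 2 — the elementary `p`-adic bounds)

HONEST FRAMING: per-curve certified theorems and census instruments; no claim on BSD in rank ≥ 2.

Cell `b2b-bsdr2` (run/shared/lean/b2b/bsd-rank2-observatory/), ANOM seat. Part 1 of the height-free
unit-cell instrument (part 2: `Rank2ObservatoryAnomHeightFree.lean`, which combines these bounds with the
tree's Kato–Perrin-Riou–Schneider inequality `padicBSD_inequality_of_kato_of_surjective_pow`). No data,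
no census verdict, no class statement; every theorem is about one Weierstrass curve `W/ℚ` and one prime.

## Contents

* §1 `p`-adic bookkeeping: `norm_det_le_of_forall_norm_le` (ultrametric Hadamard bound: a matrix over
  `ℚ_[p]` with entries of norm `≤ c`, `0 ≤ c`, has `‖det‖ ≤ c ^ n`), `le_valuation_of_norm_le_zpow`,
  `natCard_primaryComponent_eq_one` (the other conversions are the tree's `valuation_eq_of_norm_eq`,
  `inv_natCast_pow_eq_zpow_neg`).
* §2 THE REGULATOR BOUND WITHOUT HEIGHTS: for odd `p` and THE canonical height datum `Dh`
  (`Dh.IsCanonical`), if `E(ℚ)` has `p`-PRIMITIVE ADMISSIBLE MULTIPLES (`∃ m, p ∤ m ∧ ∀ P` non-torsion,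
  `IsAdmissible p (m • P)`), then every pairing value has norm `≤ p⁻¹` (`norm_pairing_le`: the canonical
  height `log_p(den) − 2 log_p σ_p` of an admissible point is a difference of Iwasawa logarithms, and
  `‖log_p x‖ ≤ p⁻¹` on `ℚ_p` for odd `p`, tree lemma `RankOneHeightFree.norm_padicLog_le`; bilinearity and
  `‖m²‖ = 1` transport the bound from `m • P` to `P`), hence `‖Reg_p(E, Dh)‖ ≤ (p⁻¹) ^ rank`
  (`norm_padicRegulator_le`). By Silverman AEC VII.2.1 / VII.6.1 the multiplier `m = #Ẽ(𝔽_p) · ∏ c_ℓ`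
  always works; it is prime to `p` iff `p ∤ a_p − 1` and `p ∤ ∏ c_ℓ` — a per-curve INPUT, not derived here.
* §3 `‖[T^r] L_p(E,T)‖ = 1` — the leading coefficient is a UNIT, not merely nonzero — from a valid symbol
  certificate `SymbolCertL` (padic-1's `Rank2ObservatoryPadicSymbolTableL`) with `p ∤ A·H − L`
  (`norm_coeff_eq_one_of_symbolTableL` / `…_of_symbolCertL`, kernel-decidable flag `SymbolCertL.unitL`):
  the Riemann sum has norm `‖αH − L‖ = ‖AH − L‖ = 1`, strictly above the truncation error.

## References

* W. Stein, C. Wuthrich, Math. Comp. 82 (2013) 1757–1792, §3, §4.1 (4.1)–(4.2). [SteinWuthrich2013]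
* B. Mazur, W. Stein, J. Tate, Doc. Math. Extra Vol. Coates (2006), §1, §4. [MazurSteinTate2006]
* B. Mazur, J. Tate, J. Teitelbaum, Invent. Math. 84 (1986), §I.10–I.13, §II.4. [MazurTateTeitelbaum1986Invent]
* J. H. Silverman, AEC 2nd ed. (2009), VII.2.1, VII.3.1, VII.6.1. [SilvermanAEC2009]
* K. Iwasawa, *Lectures on `p`-adic `L`-functions* (1972), §4.4. [Iwasawa1972PadicL]
-/

set_option autoImplicit false

-- single-conjunct summit: `Summit.BirchSwinnertonDyer.BirchSwinnertonDyer.…` repeats the name by design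
set_option linter.dupNamespace false

noncomputable section

open scoped Classical MatrixGroups ModularForm

open CongruenceSubgroup WeierstrassCurve Literature.NumberTheory.EllipticCurves
  Literature.NumberTheory.EllipticCurves.ModularForms
  Literature.NumberTheory.EllipticCurves.Rank1Residual
  Literature.NumberTheory.EllipticCurves.Rank1Residual.Typed
  Literature.NumberTheory.EllipticCurves.Wuthrich2014
  Summit.BirchSwinnertonDyer.Rank1Residual.X2

namespace Summit.BirchSwinnertonDyer.BirchSwinnertonDyer.Rank2Observatory

/-! ## §1. `p`-adic bookkeeping -/

section Padic

variable {p : ℕ} [Fact p.Prime]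

/-- A natural number prime to `p` is a `p`-adic unit. [folklore] -/
theorem norm_natCast_eq_one_of_not_dvd {n : ℕ} (hn : ¬ p ∣ n) : ‖(n : ℚ_[p])‖ = 1 := by
  rw [Padic.norm_natCast_eq_one_iff]
  exact (Nat.Prime.coprime_iff_not_dvd Fact.out).mpr hn

/-- From a norm bound to a valuation bound: `x ≠ 0`, `‖x‖ ≤ p^{-k} ⇒ k ≤ ord_p x`. [folklore] -/
theorem le_valuation_of_norm_le_zpow {x : ℚ_[p]} (hx : x ≠ 0) {k : ℤ}
    (h : ‖x‖ ≤ (p : ℝ) ^ (-k)) : k ≤ x.valuation := by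
  have hp1 : (1 : ℝ) < p := by exact_mod_cast (Fact.out : p.Prime).one_lt
  rw [Padic.norm_eq_zpow_neg_valuation hx] at h
  have := (zpow_le_zpow_iff_right₀ hp1).mp h
  omega

/-- **Ultrametric Hadamard bound.** A square matrix over `ℚ_p` with all entries of norm `≤ c` has
determinant of norm `≤ c^n` (Leibniz expansion: each of the `n!` signed products has norm `≤ c^n`, and
the norm is non-archimedean). [folklore] -/
theorem norm_det_le_of_forall_norm_le {ι : Type*} [Fintype ι] (M : Matrix ι ι ℚ_[p]) {c : ℝ}
    (hc : 0 ≤ c) (h : ∀ i j, ‖M i j‖ ≤ c) : ‖M.det‖ ≤ c ^ Fintype.card ι := by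
  rw [Matrix.det_apply']
  refine IsUltrametricDist.norm_sum_le_of_forall_le_of_nonneg (pow_nonneg hc _) fun σ _ => ?_
  rw [norm_mul]
  have hsign : ‖((Equiv.Perm.sign σ : ℤ) : ℚ_[p])‖ = 1 := by
    rcases Int.units_eq_one_or (Equiv.Perm.sign σ) with h1 | h1 <;> simp [h1]
  rw [hsign, one_mul]
  calc ‖∏ i, M (σ i) i‖ ≤ ∏ i, ‖M (σ i) i‖ := Finset.norm_prod_le _ _
    _ ≤ ∏ _i : ι, c := Finset.prod_le_prod (fun i _ => norm_nonneg _) fun i _ => h _ _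
    _ = c ^ Fintype.card ι := by rw [Finset.prod_const, Finset.card_univ]

/-- A finite abelian `p`-primary group of order prime to `p` is trivial. [folklore] -/
theorem natCard_primaryComponent_eq_one (p : ℕ) [Fact p.Prime] {G : Type*} [AddCommGroup G]
    [Finite (AddCommGroup.primaryComponent G p)]
    (h : ¬ p ∣ Nat.card (AddCommGroup.primaryComponent G p)) :
    Nat.card (AddCommGroup.primaryComponent G p) = 1 := by
  have hp : p.Prime := Fact.out
  set P := AddCommGroup.primaryComponent G p
  have hy : ∀ y : P, y = 0 := by
    intro y
    obtain ⟨k, hk⟩ := (AddCommGroup.mem_primaryComponent).1 y.2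
    have hky : p ^ k • y = 0 := Subtype.ext (by simpa using hk)
    have hdvd : addOrderOf y ∣ p ^ k := addOrderOf_dvd_of_nsmul_eq_zero hky
    obtain ⟨j, -, hj⟩ := (Nat.dvd_prime_pow hp).mp hdvd
    have hcard : p ^ j ∣ Nat.card P := hj ▸ addOrderOf_dvd_natCard y
    rcases Nat.eq_zero_or_pos j with hj0 | hjpos
    · rw [hj0, pow_zero] at hj
      exact AddMonoid.addOrderOf_eq_one_iff.mp hj
    · exact absurd (dvd_trans (dvd_pow_self p hjpos.ne') hcard) h
  exact Nat.card_eq_one_iff_unique.mpr ⟨⟨fun a b => by rw [hy a, hy b]⟩, ⟨0⟩⟩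

end Padic

/-! ## §2. The canonical `p`-adic height takes values in `pℤ_p`; the regulator bound -/

section Height

variable {W : WeierstrassCurve ℚ} {p : ℕ} [Fact p.Prime]

/-- **`‖ĥ_p(P)‖ ≤ p⁻¹` for the sigma formula at every point** (`p` odd): `canonicalPAdicHeight` is
`log_p(den x) − 2 log_p σ_p(−x/y)`, each Iwasawa logarithm of norm `≤ p⁻¹` (`norm_padicLog_le`).
[cite: SteinWuthrich2013, §4.1 eq. (4.1)] [cite: Iwasawa1972PadicL, §4.4] -/
theorem norm_canonicalPAdicHeight_le (W : WeierstrassCurve ℚ) (p : ℕ) [Fact p.Prime] (hp2 : p ≠ 2)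
    (P : W.toAffine.Point) : ‖W.canonicalPAdicHeight p P‖ ≤ (p : ℝ)⁻¹ := by
  rcases P with _ | ⟨x, y, h⟩
  · show ‖(0 : ℚ_[p])‖ ≤ _
    rw [norm_zero]; positivity
  · show ‖padicLog p ((x.den : ℚ) : ℚ_[p]) -
        2 * padicLog p (W.padicSigmaEval p (-(x : ℚ_[p]) / y))‖ ≤ _
    refine (padic_norm_sub_le_max _ _).trans (max_le (norm_padicLog_le hp2 _) ?_)
    have h2 : ‖(2 : ℚ_[p])‖ ≤ 1 := by
      have := Padic.norm_int_le_one (p := p) (2 : ℤ)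
      simpa using this
    rw [norm_mul]
    calc ‖(2 : ℚ_[p])‖ * ‖padicLog p (W.padicSigmaEval p (-(x : ℚ_[p]) / y))‖
        ≤ 1 * (p : ℝ)⁻¹ := mul_le_mul h2 (norm_padicLog_le hp2 _) (norm_nonneg _) zero_le_one
      _ = (p : ℝ)⁻¹ := one_mul _

/-- **`‖⟨P, P⟩_p‖ ≤ p⁻¹` for THE canonical height** (`p` odd) at every `P ∈ E(ℚ)`, given `p`-primitive
admissible multiples (`m·P` admissible for every non-torsion `P`, `p ∤ m`): `m² ⟨P,P⟩ = ĥ_p(mP)` and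
`‖m‖ = 1`; torsion `P` pair to `0`. No height is computed. [cite: SteinWuthrich2013, §4.1 eq. (4.1)]
[cite: MazurSteinTate2006, §1] -/
theorem norm_pairing_self_le (hp2 : p ≠ 2) {Dh : PAdicHeightData W p} (hDh : Dh.IsCanonical)
    {m : ℕ} (hm : ¬ p ∣ m)
    (hadm : ∀ P : W.toAffine.Point, ¬ IsOfFinAddOrder P → W.IsAdmissible p (m • P))
    (P : W.toAffine.Point) : ‖Dh.pairing P P‖ ≤ (p : ℝ)⁻¹ := by
  by_cases hP : IsOfFinAddOrder P
  · rw [Dh.map_torsion P P hP, norm_zero]; positivity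
  have hmm : Dh.pairing (m • P) (m • P) = ((m : ℚ_[p]) * (m : ℚ_[p])) * Dh.pairing P P := by
    rw [map_nsmul, Dh.symm (m • P) P, map_nsmul, smul_smul, nsmul_eq_mul, Nat.cast_mul]
  have hh : ‖((m : ℚ_[p]) * (m : ℚ_[p])) * Dh.pairing P P‖ ≤ (p : ℝ)⁻¹ := by
    rw [← hmm, hDh (m • P) (hadm P hP)]
    exact norm_canonicalPAdicHeight_le W p hp2 (m • P)
  rw [norm_mul, norm_mul, norm_natCast_eq_one_of_not_dvd hm, one_mul, one_mul] at hh
  exact hh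

/-- **Every value of THE canonical height pairing lies in `pℤ_p`** (`p` odd, `p`-primitive admissible
multiples): `2⟨P,Q⟩ = ⟨P+Q,P+Q⟩ − ⟨P,P⟩ − ⟨Q,Q⟩` and `‖2‖ = 1`. [cite: SteinWuthrich2013, §4.1 eq. (4.1)]
[cite: MazurTateTeitelbaum1986Invent, §II.4] -/
theorem norm_pairing_le (hp2 : p ≠ 2) {Dh : PAdicHeightData W p} (hDh : Dh.IsCanonical)
    {m : ℕ} (hm : ¬ p ∣ m)
    (hadm : ∀ P : W.toAffine.Point, ¬ IsOfFinAddOrder P → W.IsAdmissible p (m • P))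
    (P Q : W.toAffine.Point) : ‖Dh.pairing P Q‖ ≤ (p : ℝ)⁻¹ := by
  have h2PQ : (2 : ℚ_[p]) * Dh.pairing P Q =
      Dh.pairing (P + Q) (P + Q) - Dh.pairing P P - Dh.pairing Q Q := by
    simp only [map_add, AddMonoidHom.add_apply]
    rw [Dh.symm Q P]; ring
  have h2 : ‖(2 : ℚ_[p])‖ = 1 := by
    rw [Padic.norm_eq_zpow_neg_valuation two_ne_zero, valuation_two_eq_zero hp2, neg_zero, zpow_zero]
  calc ‖Dh.pairing P Q‖ = ‖(2 : ℚ_[p]) * Dh.pairing P Q‖ := by rw [norm_mul, h2, one_mul]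
    _ = ‖Dh.pairing (P + Q) (P + Q) - Dh.pairing P P - Dh.pairing Q Q‖ := by rw [h2PQ]
    _ ≤ (p : ℝ)⁻¹ :=
      (padic_norm_sub_le_max _ _).trans (max_le ((padic_norm_sub_le_max _ _).trans
        (max_le (norm_pairing_self_le hp2 hDh hm hadm _) (norm_pairing_self_le hp2 hDh hm hadm _)))
        (norm_pairing_self_le hp2 hDh hm hadm _))

/-- **Height-free Gram-determinant bound**: for THE canonical height at odd `p` and `p`-primitive
admissible multiples, the `p`-adic regulator of ANY finite family of points has norm `≤ p^{-#family}`
(all Gram entries lie in `pℤ_p`; ultrametric Hadamard). [cite: MazurTateTeitelbaum1986Invent, §II.4]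
[cite: SteinWuthrich2013, §4.1 eq. (4.1)] -/
theorem norm_padicRegulatorOf_le (hp2 : p ≠ 2) {Dh : PAdicHeightData W p} (hDh : Dh.IsCanonical)
    {m : ℕ} (hm : ¬ p ∣ m)
    (hadm : ∀ P : W.toAffine.Point, ¬ IsOfFinAddOrder P → W.IsAdmissible p (m • P))
    {ι : Type*} [Fintype ι] (P : ι → W.toAffine.Point) :
    ‖padicRegulatorOf Dh P‖ ≤ ((p : ℝ)⁻¹) ^ Fintype.card ι :=
  norm_det_le_of_forall_norm_le _ (by positivity) fun i j => by
    show ‖Dh.pairing (P i) (P j)‖ ≤ _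
    exact norm_pairing_le hp2 hDh hm hadm (P i) (P j)

/-- **Height-free regulator bound: `‖Reg_p(E, Dh)‖ ≤ p^{-rank E(ℚ)}`, i.e. `ord_p Reg_p ≥ r`**, for THE
canonical height at odd `p`, given `p`-primitive admissible multiples — no height, regulator or
generator is computed (in MST's normalisation `Reg^{MST} = p^{-r} Reg_p`: `ord_p Reg^{MST} ≥ 0`).
[cite: MazurTateTeitelbaum1986Invent, §II.4] [cite: SteinWuthrich2013, §4.1 eq. (4.1)–(4.2)]
[cite: MazurSteinTate2006, §1] -/
theorem norm_padicRegulator_le [W.IsElliptic] (hp2 : p ≠ 2) {Dh : PAdicHeightData W p}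
    (hDh : Dh.IsCanonical)
    {m : ℕ} (hm : ¬ p ∣ m)
    (hadm : ∀ P : W.toAffine.Point, ¬ IsOfFinAddOrder P → W.IsAdmissible p (m • P)) :
    ‖padicRegulator Dh‖ ≤ ((p : ℝ)⁻¹) ^ W.mordellWeilRank := by
  unfold padicRegulator
  split_ifs with h
  · have hB : IsMordellWeilBasis h.choose_spec.choose := h.choose_spec.choose_spec
    have hcard : Fintype.card (Fin h.choose) = W.mordellWeilRank :=
      IsMordellWeilBasis.card_eq_holds (W := W) hB
    rw [← hcard]
    exact norm_padicRegulatorOf_le hp2 hDh hm hadm _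
  · rw [norm_zero]; positivity

end Height

/-! ## §3. `‖[T^r] L_p‖ = 1` from a valid symbol certificate with `p ∤ A·H − L` -/

section UnitCoeff

variable (p : ℕ) [Fact p.Prime]

/-- **`[T^r] L_p` is a `p`-adic UNIT from a level-`p^{n+1}` symbol table and the digits of `α`** (odd
good ordinary `p`, `p ∤ r!`, `n ≥ 1`): with `A ≡ α (mod p^n)` and `p ∤ A·ΣHi − ΣLo` one gets
`‖RS(r, n)‖ = ‖α ΣHi − ΣLo‖ = ‖A ΣHi − ΣLo‖ = 1 > p^{-n} ≥` the truncation error, so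
`‖[T^r]L_p‖ = ‖RS(r,n)‖ = 1` (`norm_padicLCoeff_eq_of_lt`). Same data as `coeff_ne_zero_of_symbolTableL`.
[cite: MazurTateTeitelbaum1986Invent, §I.10–I.13] [cite: SteinWuthrich2013, §3] -/
theorem norm_coeff_eq_one_of_symbolTableL (hp2 : p ≠ 2) (W : WeierstrassCurve ℚ) [W.IsElliptic]
    [W.IsGloballyMinimal] {N : ℕ} [NeZero N] {f : CuspForm (Gamma0 N) 2}
    (hord : IsOrdinaryAt W p) (hf : IsNewformOf W f) {r : ℕ} (hr : ¬ p ∣ r.factorial) (n : ℕ)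
    (tabHi tabLo : List ℤ) (D : ℚ) (hD : ‖(D : ℚ_[p])‖ = 1) (H L A : ℤ)
    (hA : (p : ℤ) ^ n ∣ A ^ 2 - W.frobeniusTrace p * A + p) (hAu : ¬ (p : ℤ) ∣ A)
    (hn : n ≠ 0) (hHL1 : ¬ (p : ℤ) ∣ A * H - L)
    (hcard : (teichSet p (n + 1)).card = torsionOrder p)
    (hunit : ∀ y ∈ teichSet p (n + 1), ∀ s : ZMod (p ^ n),
      ¬ p ∣ (y * ((1 + p : ℕ) : ZMod (p ^ (n + 1))) ^ s.val).val)
    (hHi : isumL p n tabHi r = H) (hLo : isumL p n tabLo r = L)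
    (hint : ∀ x : ℚ, ‖(ratPlusSymbol f x : ℚ_[p])‖ ≤ 1)
    (htab : ∀ u : ℕ, u < p ^ (n + 1) → ¬ p ∣ u →
      ratPlusSymbol f ((u : ℚ) / (p : ℚ) ^ (n + 1)) = (tabHi.getD u 0 : ℚ) / D ∧
      ratPlusSymbol f ((u : ℚ) / (p : ℚ) ^ n) = (tabLo.getD u 0 : ℚ) / D) :
    ‖PowerSeries.coeff r (padicLFunction f (unitRoot W p : ℚ_[p]))‖ = 1 := by
  have hpP : p.Prime := Fact.out
  have hp1 : (1 : ℝ) < p := by exact_mod_cast hpP.one_lt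
  have hα : ‖(unitRoot W p : ℚ_[p])‖ = 1 := norm_unitRoot_holds W p hord
  have hαA := norm_unitRoot_sub_int_le p W hord A n hA hAu
  set α : ℚ_[p] := (unitRoot W p : ℚ_[p]) with hαdef
  have hα0 : α ≠ 0 := fun h => by rw [h, norm_zero] at hα; exact zero_ne_one hα
  have hD0 : (D : ℚ_[p]) ≠ 0 := fun h => by rw [h, norm_zero] at hD; exact zero_ne_one hD
  -- `‖RS(r, n)‖ = 1`
  have hRS : ‖padicLRiemannSum f α r n‖ = 1 := by
    rw [padicLRiemannSum_eq_isumL p f _ r n hp2 tabHi tabLo D hcard hunit htab, hHi, hLo]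
    have hαinv : α⁻¹ * α = 1 := inv_mul_cancel₀ hα0
    have hfactor : α⁻¹ ^ (n + 1) * ((((H : ℤ) : ℚ) / D : ℚ) : ℚ_[p]) -
        α⁻¹ ^ (n + 2) * ((((L : ℤ) : ℚ) / D : ℚ) : ℚ_[p]) =
          α⁻¹ ^ (n + 2) * ((D : ℚ_[p]))⁻¹ * (α * H - L) := by
      push_cast [Rat.cast_div]
      rw [div_eq_mul_inv, div_eq_mul_inv]
      linear_combination (-(α⁻¹ ^ (n + 1) * ((H : ℤ) : ℚ_[p]) * ((D : ℚ_[p]))⁻¹)) * hαinv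
    rw [hfactor, norm_mul, norm_mul, norm_pow, norm_inv, hα, inv_one, one_pow, one_mul, norm_inv, hD,
      inv_one, one_mul]
    have h1 : ‖(((A * H - L : ℤ)) : ℚ_[p])‖ = 1 := by
      have hle := Padic.norm_int_le_one (p := p) (A * H - L)
      have hlt : ¬ ‖(((A * H - L : ℤ)) : ℚ_[p])‖ < 1 := by rwa [Padic.norm_intCast_lt_one_iff]
      exact le_antisymm hle (not_lt.mp hlt)
    have h2 : ‖(α - A) * (H : ℚ_[p])‖ < 1 := by
      rw [norm_mul]
      calc ‖α - A‖ * ‖((H : ℤ) : ℚ_[p])‖ ≤ (p : ℝ) ^ (-(n : ℤ)) * 1 :=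
            mul_le_mul hαA (Padic.norm_int_le_one H) (norm_nonneg _)
              (zpow_nonneg (Nat.cast_nonneg _) _)
        _ < 1 := by rw [mul_one]; exact zpow_lt_one_of_neg₀ hp1 (by omega)
    have hsplit : α * H - L = (((A * H - L : ℤ)) : ℚ_[p]) + (α - A) * H := by push_cast; ring
    rw [hsplit, Padic.add_eq_max_of_ne (by rw [h1]; exact h2.ne'), h1, max_eq_left h2.le]
  -- the truncation error `p^{-n} < 1 = ‖RS‖`
  have hfac : ‖((r.factorial : ℕ) : ℚ_[p])‖ = 1 := by
    rw [Padic.norm_natCast_eq_one_iff]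
    exact (Nat.Prime.coprime_iff_not_dvd Fact.out).mpr hr
  have hC := norm_msdMeasure_le_one p f α hα hint
  have hlt : (1 : ℝ) / ‖((r.factorial : ℕ) : ℚ_[p])‖ * (p : ℝ) ^ (-n : ℤ) <
      ‖padicLRiemannSum f α r n‖ := by
    rw [hfac, div_one, one_mul, hRS]
    exact zpow_lt_one_of_neg₀ hp1 (by omega)
  rw [coeff_padicLFunction, (norm_padicLCoeff_eq_of_lt (msdMeasure_distribution_of_isNewformOf hord hf)
    ((norm_nonneg _).trans (hC 0 0)) hC hlt).1, hRS]

/-- The Boolean UNIT test of a `SymbolCertL` (kernel-evaluated): `p ∤ A·H − L`. Together with `validL`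
(`p^n ∤ A·H − L`, so `n ≥ 1`) it certifies `‖[T^r] L_p‖ = 1`. [cite: MazurTateTeitelbaum1986Invent, §I.10–I.13] -/
def SymbolCertL.unitL (c : SymbolCertL) : Bool :=
  decide (¬ (p : ℤ) ∣ c.A * c.H - c.L)

/-- **`‖[T^r] L_p‖ = 1` from a VALID `SymbolCertL` passing the UNIT test** (`norm_coeff_eq_one_of_symbolTableL`
with the decidable side conditions bundled; `hap` identifies the Frobenius trace used for `A`).
[cite: MazurTateTeitelbaum1986Invent, §I.10–I.13] [cite: SteinWuthrich2013, §3] -/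
theorem norm_coeff_eq_one_of_symbolCertL (W : WeierstrassCurve ℚ) [W.IsElliptic] [W.IsGloballyMinimal]
    {N : ℕ} [NeZero N] {f : CuspForm (Gamma0 N) 2} (hord : IsOrdinaryAt W p) (hf : IsNewformOf W f)
    {ap : ℤ} (hap : W.frobeniusTrace p = ap) (c : SymbolCertL) (hc : c.validL p ap = true)
    (hu : c.unitL p = true) (D : ℚ)
    (hD : ‖(D : ℚ_[p])‖ = 1) (hint : ∀ x : ℚ, ‖(ratPlusSymbol f x : ℚ_[p])‖ ≤ 1)
    (htab : ∀ u : ℕ, u < p ^ (c.n + 1) → ¬ p ∣ u →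
      ratPlusSymbol f ((u : ℚ) / (p : ℚ) ^ (c.n + 1)) = (c.tabHi.getD u 0 : ℚ) / D ∧
      ratPlusSymbol f ((u : ℚ) / (p : ℚ) ^ c.n) = (c.tabLo.getD u 0 : ℚ) / D) :
    ‖PowerSeries.coeff c.r (padicLFunction f (unitRoot W p : ℚ_[p]))‖ = 1 := by
  obtain ⟨hp2, hr, hA, hAu, hHL, hcard, hunit, hHi, hLo⟩ := of_decide_eq_true hc
  have hHL1 : ¬ (p : ℤ) ∣ c.A * c.H - c.L := of_decide_eq_true hu
  have hn : c.n ≠ 0 := by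
    intro h0
    rw [h0, pow_zero] at hHL
    exact hHL (one_dvd _)
  rw [← hap] at hA
  exact norm_coeff_eq_one_of_symbolTableL p hp2 W hord hf hr c.n c.tabHi c.tabLo D hD c.H c.L c.A hA
    hAu hn hHL1 hcard hunit hHi hLo hint htab

end UnitCoeff

end Summit.BirchSwinnertonDyer.BirchSwinnertonDyer.Rank2Observatory

end
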